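/-
Origin: expansion seat `planner-pub-hodgecm-mc-glue-1-g11-0`, handover #SG17 2026-08-20T16:55:47Z md5 31fdabb61647 (REPLACE; pre md5 e4717c8a5084 → new md5 31fdabb61647; 226 l.; (μ4) scope-guard rewrite of the RUN-55 installed file; family glue-1; compiled ok 0 proof-hole) (`HOME/mc/pub-hodgecm-mc-glue-1-g11/stage56/HodgeCM/Model/E2InstanceOGR21AEPISCW.lean`, md5 31fdabb61647, 226 lines);
landed by the second packager p2 gen 10 (p2-g10) in gate run 56 REPLACES the earlier landed copy of `HodgeCM/Model/E2InstanceOGR21AEPISCW.lean` (seat copy carried the packager Origin header of an earlier run (stripped)).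
-/
/-
Origin: CONSTRUCTION seat `planner-pub-hodgecm-mc-glue-1-g10-0` (unit pub-hodgecm-mc-glue-1-g10, gen 10 of mc-glue-1, node E ASSEMBLER),
generated from `stage44/HodgeCM/Model/E2InstanceOGR21AEPISC.lean` (#397) and the binder texts of the installed `HodgeCM/Model/HypCensus/HypOfCensus.lean`
(binder-2 RUN-42 #56) by `tools/gen_ogiscw.py`; KERNEL only: 1 theorem, 0 defs; intended closure {propext, Classical.choice, Quot.sound}.
The ROW-4/16/18/19 W PIN CHILD of the C pin child: `W` pinned at the census family AT THE S PIN'S CHARACTER, rows 18/19 at #56, row 16 at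
binder-1 #37 `Gen12PinsP.gen12_ROG_of_GOG`; record status is the lead's ruling, not this file's claim.
-/
import Summits.HodgeConjecture.HodgeCM.Model.E2InstanceOGR21AEPISC
import Summits.HodgeConjecture.HodgeCM.Model.HypCensus.HypOfCensus
import Summits.HodgeConjecture.HodgeCM.Model.Binders.Gen12PinsROG

/-!
# E2InstanceOGR21AEPISCW — the row-4/16/18/19 W pin child of `perL_picardCM_r21AEOGISC`

`perL_picardCM_r21AEOGISCW` = `perL_picardCM_r21AEOGISC` (#397: #395 with rows 12/14/15 at carch-1's `archKTypeOfSide` over sinst-1's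
`SROG`; 22 groups) with row 4 `W` PINNED at binder-2's census family AT THE S PIN'S CHARACTER —
`W := HypCensus.Wcm hGR η′ hη′ hηc′`, `η′ := EtaChi.η χV (SInstance.χWR hGR hGR₀ hGR₁ μ)` (`hη′ hηc′ := EtaChi.hη / EtaChi.hηc`), NOT the
free-η pin of #396: binder-1's staged #37 notes that the seesaw identity couples `W.ρ` and the line representations of `S` through ONE
character, so rows 16/17 can only be produced when W and S share it — with rows 18 `hyp12` / 19 `hyp34` DISCHARGED by binder-2's E-currency
theorems `HypCensus.hyp12_of_census` / `hyp34_of_census` (RUN-42 #56) at η′, pointwise at the bit `orientBitι L ι₁` (their residual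
families `jD` (DATA: equivariance-slot choice per place), `hκ` ((V-val) K∞-letter identity), `homg`/`homg₃₄` (printed-torus equivariance of
`ins`/`ins₃₄`), `hdense₁₂`/`hdense₃₄` (density of the `ins` span in `W.SK`) become E-level inputs, texts verbatim from #56 up to namespace
qualification and `η ↦ η′`), and row 16 `gen12` DISCHARGED WITH NO RESIDUAL on the guard by binder-1's #37
`Gen12PinsP.gen12_ROG_of_GOG hGR χV hGR₀..₃ μ hΔ₁ hΔ₂ hΔ₃ hHD hI h₁ h₃′ (orientBitι L ι₁) hA V c hG hc h6` (`Binders/Gen12PinsROG`, over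
#36 `Gen12PinsTotalP` / #35; its model `pinT … (Gen12Pins.Wg @hGR @η′ @hη′ @hηc′ @τSyl @TSyl @hTSyl) (SROG …) μ` IS this child's model by
unfolding the reducible `pinT`/`Wg`/`Wcm`), the guard `hG : SInstance.GOG V c := ⟨hcan, (thetaModel_goodCtx_iff _ …).mp hc⟩` read off the
row's own hypotheses exactly as in #397.  Row 17 `real34` STAYS (binder-1-g11's P2 re-typing of #28–#31 at the guarded pin; K34-PLAN §3).
Binder groups: `hA hGR χV hGR₀ hGR₁ hGR₂ hGR₃ μ hΔ₁ hΔ₂ hΔ₃ hR hΘ harch₀ hχ₀ harch₁ hχ₁ real34 jD hκ homg homg₃₄ hdense₁₂ hdense₃₄`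
(24 = 22 − 4 + 6); the (C-LINE1) LABEL of #397 on `harch₁`/`hχ₁` stands verbatim (NOT dischargeable at the `SROG` pin; pin-side under R1 at
the ν-carrying successor pin; displayed AS TYPED, not PROVE residuals with an owner); every remaining text is #397's with the family `W`
replaced by the pin term; conclusion `Universe.PerL` unchanged; proof = ONE application.  ADDITIVE LEAF of the closing chain; no new
definition, record or cite enters; nothing of PerL ∕ QW8 is claimed.
-/

noncomputable section

open scoped TensorProduct InnerProductSpace Matrix

open Literature.NumberTheory.Automorphic Literature.NumberTheory.Weil1964
open Literature.NumberTheory.GelbartRogawski1991.UnitaryDualPair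
open HodgeCM.Adelic HodgeCM.PerL34
open scoped Classical
open Literature.Geometry.ComplexHyperbolic.BallModel (U21 x₀ stabilizerEquivK21)
open Literature.NumberTheory.Automorphic.U21 (K21 matA sclD)

namespace HodgeCM

namespace Model

open HodgeCM.Model.ArchSideTerm
open HodgeCM.Universe (AdelicThetaCore AdelicThetaCore₀ SideData ThetaModel ModelAxiomsPerL)
open Literature.AlgebraicGeometry.HodgeTheory
open Literature.AlgebraicGeometry.ComplexMultiplication (Shimura1998_Thm3_isogenousPower Shimura1998_Thm2_Cor)
open Literature.NumberTheory.Automorphic.PicardCM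
open Literature.NumberTheory.Transcendental (Arapura2012_Cor_15_4_6)
open HodgeCM.CMTypeOps (inflate)
open HodgeCM.Model.SupplyResidual (ClassSupplyPackN)
open HodgeCM.Model.ThetaSpace

variable (hHD : exists_isReal_hodgeModel) (hI : hodgePQ_independent_of_hodgeModel)
  (h₁ : BallQuotientUniformised)  (h₃ : CMAbelianVarietyEigenbasisRealised)

/-- **W-PINNED CHILD of the C pin child** (`W` at the census family at the S pin's character; rows 18/19 at #56, row 16 at binder-1 #37,
hypothesis-free on the guard; 24 binder groups; (C-LINE1) label of #397 on `harch₁`/`hχ₁` stands). -/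
theorem perL_picardCM_r21AEOGISCW (hA : Arapura2012_Cor_15_4_6)
    (hGR : ∀ {L : CMField} {ι₁ : L →+* ℂ} (V : HermSpace3 L ι₁) (c : SeesawCtx L),
      (cmSplittingDatum (L : Type) finProdFinEquiv (frameD V) (frameD_real V) (frameD_ne V) (dW c.D) (dW_real c.D)
        (dW_ne c.D)).CompatibleSplitting)
    (χV : ∀ {L : CMField} {ι₁ : L →+* ℂ} (_V : HermSpace3 L ι₁) (_c : SeesawCtx L),
      ContinuousMonoidHom (relNormOneIdeles (↥(NumberField.maximalRealSubfield (L : Type))) (L : Type) ⧸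
        relNormOneRat (↥(NumberField.maximalRealSubfield (L : Type))) (L : Type)) Circle)
    (hGR₀ : ∀ {L : CMField} {ι₁ : L →+* ℂ} (V : HermSpace3 L ι₁) (c : SeesawCtx L),
      (cmSplittingDatum (L : Type) (e₁) (frameD V) (frameD_real V) (frameD_ne V) (lineVec (L : Type) (dW c.D 0))
        (fun _ => dW_real c.D 0) (fun _ => dW_ne c.D 0)).CompatibleSplitting)
    (hGR₁ : ∀ {L : CMField} {ι₁ : L →+* ℂ} (V : HermSpace3 L ι₁) (c : SeesawCtx L),
      (cmSplittingDatum (L : Type) (e₁) (frameD V) (frameD_real V) (frameD_ne V) (lineVec (L : Type) (dW c.D 1))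
        (fun _ => dW_real c.D 1) (fun _ => dW_ne c.D 1)).CompatibleSplitting)
    (hGR₂ : ∀ {L : CMField} {ι₁ : L →+* ℂ} (V : HermSpace3 L ι₁) (c : SeesawCtx L),
      (cmSplittingDatum (L : Type) (e₁) (frameD V) (frameD_real V) (frameD_ne V) (lineVec (L : Type) (dW' c.D 0))
        (fun _ => dW'_real c.D 0) (fun _ => dW'_ne c.D 0)).CompatibleSplitting)
    (hGR₃ : ∀ {L : CMField} {ι₁ : L →+* ℂ} (V : HermSpace3 L ι₁) (c : SeesawCtx L),
      (cmSplittingDatum (L : Type) (e₁) (frameD V) (frameD_real V) (frameD_ne V) (lineVec (L : Type) (dW' c.D 1))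
        (fun _ => dW'_real c.D 1) (fun _ => dW'_ne c.D 1)).CompatibleSplitting)
    (μ : ∀ {L : CMField}, SeesawCtx L → Fin 4 → NumberField.InfinitePlace L → ℤ)
    (hΔ₁ : ∀ {L : CMField} {ι₁ : L →+* ℂ} (V : HermSpace3 L ι₁) (c : SeesawCtx L), ∀ hc : SInstance.GOG V c,
      slotTypeVec V c (hGR V c) (hGR₀ V c) (hGR₁ V c) (hGR₂ V c) (hGR₃ V c) (SInstance.hG_GOG V c hc) 1 -
        slotTypeVec V c (hGR V c) (hGR₀ V c) (hGR₁ V c) (hGR₂ V c) (hGR₃ V c) (SInstance.hG_GOG V c hc) 0 = μ c 1 - μ c 0)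
    (hΔ₂ : ∀ {L : CMField} {ι₁ : L →+* ℂ} (V : HermSpace3 L ι₁) (c : SeesawCtx L), ∀ hc : SInstance.GOG V c,
      slotTypeVec V c (hGR V c) (hGR₀ V c) (hGR₁ V c) (hGR₂ V c) (hGR₃ V c) (SInstance.hG_GOG V c hc) 2 -
        slotTypeVec V c (hGR V c) (hGR₀ V c) (hGR₁ V c) (hGR₂ V c) (hGR₃ V c) (SInstance.hG_GOG V c hc) 0 = μ c 2 - μ c 0)
    (hΔ₃ : ∀ {L : CMField} {ι₁ : L →+* ℂ} (V : HermSpace3 L ι₁) (c : SeesawCtx L), ∀ hc : SInstance.GOG V c,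
      slotTypeVec V c (hGR V c) (hGR₀ V c) (hGR₁ V c) (hGR₂ V c) (hGR₃ V c) (SInstance.hG_GOG V c hc) 3 -
        slotTypeVec V c (hGR V c) (hGR₀ V c) (hGR₁ V c) (hGR₂ V c) (hGR₃ V c) (SInstance.hG_GOG V c hc) 0 = μ c 3 - μ c 0)
    (hR : DeligneMilne1982_Thm_6_20_full)
    (hΘ : ∀ {L : CMField} {ι₁ : L →+* ℂ} (V : HermSpace3 L ι₁) (c : SeesawCtx L),
      (thetaModelOf hHD hI h₁ (cmAbelianVarietyRealised_of_eigenbasis hHD hI h₃) (orientBitι L ι₁) (embOf hHD hI h₁ (cmAbelianVarietyRealised_of_eigenbasis hHD hI h₃)) (coverOf hHD hI h₁ (cmAbelianVarietyRealised_of_eigenbasis hHD hI h₃) hA) (wmOfInput (HypCensus.Wcm hGR (@EtaChi.η @χV (@SInstance.χWR @hGR @hGR₀ @hGR₁ @μ)) (@EtaChi.hη @χV (@SInstance.χWR @hGR @hGR₀ @hGR₁ @μ)) (@EtaChi.hηc @χV (@SInstance.χWR @hGR @hGR₀ @hGR₁ @μ)))) (thetaOf _ (thetaClassInputOf _ (fun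 V c => thetaSpaceInputOf hHD hI h₁ (cmAbelianVarietyRealised_of_eigenbasis hHD hI h₃) (SInstance.SROG @hGR @χV @hGR₀ @hGR₁ @hGR₂ @hGR₃ @μ hΔ₁ hΔ₂ hΔ₃) V c))) (d12Of μ) (d34Of μ)).GoodCtx ι₁ c → Module.finrank ℚ c.K = 6 ∧ IsNormalClosure ℚ c.K L ∧ (Module.finrank ℚ L = 24 ∨ Module.finrank ℚ L = 48) →
      (NumberField.InfinitePlace.mk ι₁).embedding = ι₁ →
      ∀ i : Fin 4, ∃ Γ₀ : Level V, ∀ Γ ≤ Γ₀,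
        ∃ D : CommonReflexInput c.K (c.Ψ i) c.σ,
          (thetaModelOf hHD hI h₁ (cmAbelianVarietyRealised_of_eigenbasis hHD hI h₃) (orientBitι L ι₁) (embOf hHD hI h₁ (cmAbelianVarietyRealised_of_eigenbasis hHD hI h₃)) (coverOf hHD hI h₁ (cmAbelianVarietyRealised_of_eigenbasis hHD hI h₃) hA) (wmOfInput (HypCensus.Wcm hGR (@EtaChi.η @χV (@SInstance.χWR @hGR @hGR₀ @hGR₁ @μ)) (@EtaChi.hη @χV (@SInstance.χWR @hGR @hGR₀ @hGR₁ @μ)) (@EtaChi.hηc @χV (@SInstance.χWR @hGR @hGR₀ @hGR₁ @μ)))) (thetaOf _ (thetaClassInputOf _ (fun V c => thetaSpaceInputOf hHD hI h₁ (cmAbelianVarietyRealised_of_eigenbasis hHD hI h₃) (SInstance.SROG @hGR @χV @hGR₀ @hGR₁ @hGR₂ @hGR₃ @μ hΔ₁ hΔ₂ hΔ₃) V c))) (d12Of μ) (d34Of μ)).Theta V c i Γ ⊆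
            Submodule.span ℂ (D.surfaceClasses hHD hI h₁ (cmAbelianVarietyRealised_of_eigenbasis hHD hI h₃) V Γ))
    (harch₀ : ∀ {L : CMField} {ι₁ : L →+* ℂ} (V : HermSpace3 L ι₁) (c : SeesawCtx L) (hV : IsAnisotropic L V.Hm) (hG : SInstance.GOG V c) (N : ℕ), ∀ a : UnitaryGroup.arch (↥(NumberField.maximalRealSubfield L)) L (NumberField.IsCMField.complexConj L) 3 V.Hm,
    UnitaryGroup.archAt (↥(NumberField.maximalRealSubfield L)) L (NumberField.IsCMField.complexConj L) 3 V.Hm (UnitaryGroup.cmPlace (L : Type) ι₁)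
        (NumberField.complexConj_smul_infinitePlace (L : Type) _) (NumberField.IsCMField.complexConj_ne_one (L : Type)) a = 1 →
    ∀ ℓ, lineRepD V c.D (hGR V c) (hGR₀ V c) (hGR₁ V c) (hGR₂ V c) (hGR₃ V c) (EtaChi.η @χV (@SInstance.χWR @hGR @hGR₀ @hGR₁ @μ) V c) 0
        (HodgeCM.Adelic.regimeEquiv L V.Hm hV
          (UnitaryGroup.archToAdelic (↥(NumberField.maximalRealSubfield L)) L (NumberField.IsCMField.complexConj L) 3 V.Hm a), 1)
        (SupplyInstance.testFun (↥(NumberField.maximalRealSubfield L)) (Fin 3)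
          (blockFamilyOfAt (L : Type) e₁ (frameD V) (frameD_real V) (frameD_ne V) (lineVec (L : Type) (dW c.D 0))
            (fun _ => dW_real c.D 0) (fun _ => dW_ne c.D 0) ι₁ (blockPosEquiv V) (blockNegEquiv V)
            (posIdxEquivUnit (SInstance.hpos_GOG V c hG).1) (negIdxEquivEmpty (SInstance.hpos_GOG V c hG).1) (degOnePDual Empty) (Literature.Analysis.SegalBargmann.binvPi 1) ℓ)
          (((SInstance.AR @SInstance.GOG @SInstance.hG_GOG @hGR @χV @hGR₀ @hGR₁ @hGR₂ @hGR₃ @μ @SInstance.hpos_GOG @hΔ₁ @hΔ₂ @hΔ₃ V c hG) 0).x₀) N) =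
      SupplyInstance.testFun (↥(NumberField.maximalRealSubfield L)) (Fin 3)
        (blockFamilyOfAt (L : Type) e₁ (frameD V) (frameD_real V) (frameD_ne V) (lineVec (L : Type) (dW c.D 0))
          (fun _ => dW_real c.D 0) (fun _ => dW_ne c.D 0) ι₁ (blockPosEquiv V) (blockNegEquiv V)
          (posIdxEquivUnit (SInstance.hpos_GOG V c hG).1) (negIdxEquivEmpty (SInstance.hpos_GOG V c hG).1) (degOnePDual Empty) (Literature.Analysis.SegalBargmann.binvPi 1) ℓ)
        (((SInstance.AR @SInstance.GOG @SInstance.hG_GOG @hGR @χV @hGR₀ @hGR₁ @hGR₂ @hGR₃ @μ @SInstance.hpos_GOG @hΔ₁ @hΔ₂ @hΔ₃ V c hG) 0).x₀) N)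
    (hχ₀ : ∀ {L : CMField} {ι₁ : L →+* ℂ} (V : HermSpace3 L ι₁) (c : SeesawCtx L) (hG : SInstance.GOG V c), ∀ u : MulAction.stabilizer U21 x₀,
    ((lineScalar_zero V c.D (hGR V c) (hGR₀ V c) (hGR₁ V c) (eta₀ V c.D (EtaChi.η @χV (@SInstance.χWR @hGR @hGR₀ @hGR₁ @μ) V c)) (u : U21) : ℂˣ) : ℂ) *
        ((matA (stabilizerEquivK21.symm u)).det ^
            (lineVacExponentsZero V c (hGR₀ V c) (SInstance.hG_GOG V c hG) (posIdxEquivUnit (SInstance.hpos_GOG V c hG).1)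
              (negIdxEquivEmpty (SInstance.hpos_GOG V c hG).1)).eP *
          sclD (stabilizerEquivK21.symm u) ^
            (lineVacExponentsZero V c (hGR₀ V c) (SInstance.hG_GOG V c hG) (posIdxEquivUnit (SInstance.hpos_GOG V c hG).1)
              (negIdxEquivEmpty (SInstance.hpos_GOG V c hG).1)).eQ) =
      star (sclD (stabilizerEquivK21.symm u)))
    (harch₁ : ∀ {L : CMField} {ι₁ : L →+* ℂ} (V : HermSpace3 L ι₁) (c : SeesawCtx L) (hV : IsAnisotropic L V.Hm) (hG : SInstance.GOG V c) (N : ℕ), ∀ a : UnitaryGroup.arch (↥(NumberField.maximalRealSubfield L)) L (NumberField.IsCMField.complexConj L) 3 V.Hm,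
    UnitaryGroup.archAt (↥(NumberField.maximalRealSubfield L)) L (NumberField.IsCMField.complexConj L) 3 V.Hm (UnitaryGroup.cmPlace (L : Type) ι₁)
        (NumberField.complexConj_smul_infinitePlace (L : Type) _) (NumberField.IsCMField.complexConj_ne_one (L : Type)) a = 1 →
    ∀ ℓ, lineRepD V c.D (hGR V c) (hGR₀ V c) (hGR₁ V c) (hGR₂ V c) (hGR₃ V c) (EtaChi.η @χV (@SInstance.χWR @hGR @hGR₀ @hGR₁ @μ) V c) 1
        (HodgeCM.Adelic.regimeEquiv L V.Hm hV
          (UnitaryGroup.archToAdelic (↥(NumberField.maximalRealSubfield L)) L (NumberField.IsCMField.complexConj L) 3 V.Hm a), 1)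
        (SupplyInstance.testFun (↥(NumberField.maximalRealSubfield L)) (Fin 3)
          (blockFamilyOfAt (L : Type) e₁ (frameD V) (frameD_real V) (frameD_ne V) (lineVec (L : Type) (dW c.D 1))
            (fun _ => dW_real c.D 1) (fun _ => dW_ne c.D 1) ι₁ (blockPosEquiv V) (blockNegEquiv V)
            (posIdxEquivUnit (SInstance.hpos_GOG V c hG).2.1) (negIdxEquivEmpty (SInstance.hpos_GOG V c hG).2.1) (degOnePDual Empty) (Literature.Analysis.SegalBargmann.binvPi 1) ℓ)
          (((SInstance.AR @SInstance.GOG @SInstance.hG_GOG @hGR @χV @hGR₀ @hGR₁ @hGR₂ @hGR₃ @μ @SInstance.hpos_GOG @hΔ₁ @hΔ₂ @hΔ₃ V c hG) 1).x₀) N) =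
      SupplyInstance.testFun (↥(NumberField.maximalRealSubfield L)) (Fin 3)
        (blockFamilyOfAt (L : Type) e₁ (frameD V) (frameD_real V) (frameD_ne V) (lineVec (L : Type) (dW c.D 1))
          (fun _ => dW_real c.D 1) (fun _ => dW_ne c.D 1) ι₁ (blockPosEquiv V) (blockNegEquiv V)
          (posIdxEquivUnit (SInstance.hpos_GOG V c hG).2.1) (negIdxEquivEmpty (SInstance.hpos_GOG V c hG).2.1) (degOnePDual Empty) (Literature.Analysis.SegalBargmann.binvPi 1) ℓ)
        (((SInstance.AR @SInstance.GOG @SInstance.hG_GOG @hGR @χV @hGR₀ @hGR₁ @hGR₂ @hGR₃ @μ @SInstance.hpos_GOG @hΔ₁ @hΔ₂ @hΔ₃ V c hG) 1).x₀) N)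
    (hχ₁ : ∀ {L : CMField} {ι₁ : L →+* ℂ} (V : HermSpace3 L ι₁) (c : SeesawCtx L) (hG : SInstance.GOG V c), ∀ u : MulAction.stabilizer U21 x₀,
    ((lineScalar_one V c.D (hGR V c) (hGR₀ V c) (hGR₁ V c) (eta₁ V c.D (EtaChi.η @χV (@SInstance.χWR @hGR @hGR₀ @hGR₁ @μ) V c)) (u : U21) : ℂˣ) : ℂ) *
        ((matA (stabilizerEquivK21.symm u)).det ^
            (lineVacExponentsOne V c (hGR₁ V c) (SInstance.hG_GOG V c hG) (posIdxEquivUnit (SInstance.hpos_GOG V c hG).2.1)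
              (negIdxEquivEmpty (SInstance.hpos_GOG V c hG).2.1)).eP *
          sclD (stabilizerEquivK21.symm u) ^
            (lineVacExponentsOne V c (hGR₁ V c) (SInstance.hG_GOG V c hG) (posIdxEquivUnit (SInstance.hpos_GOG V c hG).2.1)
              (negIdxEquivEmpty (SInstance.hpos_GOG V c hG).2.1)).eQ) =
      star (sclD (stabilizerEquivK21.symm u)))
    (real34 : ∀ {L : CMField} {ι₁ : L →+* ℂ} (V : HermSpace3 L ι₁) (c : SeesawCtx L),
      (thetaModelOf hHD hI h₁ (cmAbelianVarietyRealised_of_eigenbasis hHD hI h₃) (orientBitι L ι₁) (embOf hHD hI h₁ (cmAbelianVarietyRealised_of_eigenbasis hHD hI h₃)) (coverOf hHD hI h₁ (cmAbelianVarietyRealised_of_eigenbasis hHD hI h₃) hA) (wmOfInput (HypCensus.Wcm hGR (@EtaChi.η @χV (@SInstance.χWR @hGR @hGR₀ @hGR₁ @μ)) (@EtaChi.hη @χV (@SInstance.χWR @hGR @hGR₀ @hGR₁ @μ)) (@EtaChi.hηc @χV (@SInstance.χWR @hGR @hGR₀ @hGR₁ @μ)))) (thetaOf _ (thetaClassInputOf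 _ (fun V c => thetaSpaceInputOf hHD hI h₁ (cmAbelianVarietyRealised_of_eigenbasis hHD hI h₃) (SInstance.SROG @hGR @χV @hGR₀ @hGR₁ @hGR₂ @hGR₃ @μ hΔ₁ hΔ₂ hΔ₃) V c))) (d12Of μ) (d34Of μ)).GoodCtx ι₁ c → Module.finrank ℚ c.K = 6 ∧ IsNormalClosure ℚ c.K L ∧ (Module.finrank ℚ L = 24 ∨ Module.finrank ℚ L = 48) →
      (NumberField.InfinitePlace.mk ι₁).embedding = ι₁ →
      Nonempty ((thetaModelOf hHD hI h₁ (cmAbelianVarietyRealised_of_eigenbasis hHD hI h₃) (orientBitι L ι₁) (embOf hHD hI h₁ (cmAbelianVarietyRealised_of_eigenbasis hHD hI h₃)) (coverOf hHD hI h₁ (cmAbelianVarietyRealised_of_eigenbasis hHD hI h₃) hA) (wmOfInput (HypCensus.Wcm hGR (@EtaChi.η @χV (@SInstance.χWR @hGR @hGR₀ @hGR₁ @μ)) (@EtaChi.hη @χV (@SInstance.χWR @hGR @hGR₀ @hGR₁ @μ)) (@EtaChi.hηc @χV (@SInstance.χWR @hGR @hGR₀ @hGR₁ @μ)))) (thetaOf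 _ (thetaClassInputOf _ (fun V c => thetaSpaceInputOf hHD hI h₁ (cmAbelianVarietyRealised_of_eigenbasis hHD hI h₃) (SInstance.SROG @hGR @χV @hGR₀ @hGR₁ @hGR₂ @hGR₃ @μ hΔ₁ hΔ₂ hΔ₃) V c))) (d12Of μ) (d34Of μ)).Real34FunBridge V c))
    (jD : ∀ {L : CMField} {ι₁ : L →+* ℂ} (_V : HermSpace3 L ι₁) (_c : SeesawCtx L), NumberField.InfinitePlace (L : Type) → Fock.EqVar → Fin 6)
    (hκ : ∀ {L : CMField} {ι₁ : L →+* ℂ} (V : HermSpace3 L ι₁) (c : SeesawCtx L)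
      (hW : (∀ j, 0 < (ι₁ ((dW c.D) j)).re) ∨ ∀ j, (ι₁ ((dW c.D) j)).re < 0), ∀ k : ↥(KInfty V),
      (((@EtaChi.η @χV (@SInstance.χWR @hGR @hGR₀ @hGR₁ @μ)) V c (HypCensus.kPair V c.D ι₁ V.sylvesterFrame (sylvesterFrame_formCongr V) k) : ℂˣ) : ℂ) *
          ((HypCensus.pinLetterChar V c.D (hGR V c) hW (HypCensus.kVLetters V c.D (HypCensus.lett V c.D k)) : Circle) : ℂ) * HypCensus.dVIota V c.D (HypCensus.lett V c.D k (HypCensus.cmPlace (L : Type) ι₁)) =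
        ((Literature.NumberTheory.Automorphic.UnitaryGroup.archKappa (L : Type) V.Hm ι₁ V.sylvesterFrame (sylvesterFrame_formCongr V) k : ℂˣ) : ℂ))
    (homg : ∀ {L : CMField} {ι₁ : L →+* ℂ} (V : HermSpace3 L ι₁) (c : SeesawCtx L)
      (hW : (∀ j, 0 < (ι₁ ((dW c.D) j)).re) ∨ ∀ j, (ι₁ ((dW c.D) j)).re < 0) (f : FinSB ↥(NumberField.maximalRealSubfield L) (Fin 6))
      (t : (HypCensus.printedAt V c.D hW (jD V c) (fun w => -μ c 0 w) (fun w => -μ c 1 w)).Tg)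
      (φ : (HypCensus.printedAt V c.D hW (jD V c) (fun w => -μ c 0 w) (fun w => -μ c 1 w)).F),
      HypCensus.omgW (HypCensus.Wcm hGR (@EtaChi.η @χV (@SInstance.χWR @hGR @hGR₀ @hGR₁ @μ)) (@EtaChi.hη @χV (@SInstance.χWR @hGR @hGR₀ @hGR₁ @μ)) (@EtaChi.hηc @χV (@SInstance.χWR @hGR @hGR₀ @hGR₁ @μ)) V c)
          (_root_.NumberField.SeesawArchTorus.printedTorusHom (HypCensus.kindOf (L : Type) (frameD V) (frameD_real V) (dW c.D) (dW_real c.D) ι₁ (HypCensus.datumAt V c.D (jD V c) (HypCensus.jIOf V c.D hW)))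
            (HypCensus.lamOf (L : Type) (frameD V) (frameD_real V) (dW c.D) (dW_real c.D) ι₁ (HypCensus.datumAt V c.D (jD V c) (HypCensus.jIOf V c.D hW)))
            (HypCensus.lamOf_ne_zero (L : Type) (frameD V) (frameD_real V) (dW c.D) (dW_real c.D) ι₁ (HypCensus.datumAt V c.D (jD V c) (HypCensus.jIOf V c.D hW)))
            (c.D.jT₁₂.toMonoidHom.comp (_root_.NumberField.SeesawArchTorus.toAdeles (L : Type)))
            (Fock.PrintDict.pinnedVacs (HypCensus.kindOf (L : Type) (frameD V) (frameD_real V) (dW c.D) (dW_real c.D) ι₁ (HypCensus.datumAt V c.D (jD V c) (HypCensus.jIOf V c.D hW)))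
              (fun w => -μ c 0 w) (fun w => -μ c 1 w)) t)
          (HypCensus.ins (L : Type) (frameD V) (frameD_real V) (frameD_ne V) (dW c.D) (dW_real c.D) (dW_ne c.D) ι₁ (HypCensus.datumAt V c.D (jD V c) (HypCensus.jIOf V c.D hW))
            (fun w => -μ c 0 w) (fun w => -μ c 1 w) f φ) =
        HypCensus.ins (L : Type) (frameD V) (frameD_real V) (frameD_ne V) (dW c.D) (dW_real c.D) (dW_ne c.D) ι₁ (HypCensus.datumAt V c.D (jD V c) (HypCensus.jIOf V c.D hW))
          (fun w => -μ c 0 w) (fun w => -μ c 1 w) f ((HypCensus.printedAt V c.D hW (jD V c) (fun w => -μ c 0 w) (fun w => -μ c 1 w)).ωT t φ))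
    (homg₃₄ : ∀ {L : CMField} {ι₁ : L →+* ℂ} (V : HermSpace3 L ι₁) (c : SeesawCtx L)
      (hW : (∀ j, 0 < (ι₁ ((dW c.D) j)).re) ∨ ∀ j, (ι₁ ((dW c.D) j)).re < 0) (f : FinSB ↥(NumberField.maximalRealSubfield L) (Fin 6))
      (t : (HypCensus.printedAt V c.D hW (jD V c) (fun w => -μ c 2 w) (fun w => -μ c 3 w)).Tg)
      (φ : (HypCensus.printedAt V c.D hW (jD V c) (fun w => -μ c 2 w) (fun w => -μ c 3 w)).F),
      HypCensus.omgW (HypCensus.Wcm hGR (@EtaChi.η @χV (@SInstance.χWR @hGR @hGR₀ @hGR₁ @μ)) (@EtaChi.hη @χV (@SInstance.χWR @hGR @hGR₀ @hGR₁ @μ)) (@EtaChi.hηc @χV (@SInstance.χWR @hGR @hGR₀ @hGR₁ @μ)) V c)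
          (_root_.NumberField.SeesawArchTorus.printedTorusHom (HypCensus.kindOf (L : Type) (frameD V) (frameD_real V) (dW c.D) (dW_real c.D) ι₁ (HypCensus.datumAt V c.D (jD V c) (HypCensus.jIOf V c.D hW)))
            (HypCensus.lamOf (L : Type) (frameD V) (frameD_real V) (dW c.D) (dW_real c.D) ι₁ (HypCensus.datumAt V c.D (jD V c) (HypCensus.jIOf V c.D hW)))
            (HypCensus.lamOf_ne_zero (L : Type) (frameD V) (frameD_real V) (dW c.D) (dW_real c.D) ι₁ (HypCensus.datumAt V c.D (jD V c) (HypCensus.jIOf V c.D hW)))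
            (c.D.jT₃₄.toMonoidHom.comp (_root_.NumberField.SeesawArchTorus.toAdeles (L : Type)))
            (Fock.PrintDict.pinnedVacs (HypCensus.kindOf (L : Type) (frameD V) (frameD_real V) (dW c.D) (dW_real c.D) ι₁ (HypCensus.datumAt V c.D (jD V c) (HypCensus.jIOf V c.D hW)))
              (fun w => -μ c 2 w) (fun w => -μ c 3 w)) t)
          (HypCensus.ins₃₄ V c.D (hGR V c) ((@EtaChi.η @χV (@SInstance.χWR @hGR @hGR₀ @hGR₁ @μ)) V c) (HypCensus.datumAt V c.D (jD V c) (HypCensus.jIOf V c.D hW)) (fun w => -μ c 2 w) (fun w => -μ c 3 w) f φ) =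
        HypCensus.ins₃₄ V c.D (hGR V c) ((@EtaChi.η @χV (@SInstance.χWR @hGR @hGR₀ @hGR₁ @μ)) V c) (HypCensus.datumAt V c.D (jD V c) (HypCensus.jIOf V c.D hW)) (fun w => -μ c 2 w) (fun w => -μ c 3 w) f
          ((HypCensus.printedAt V c.D hW (jD V c) (fun w => -μ c 2 w) (fun w => -μ c 3 w)).ωT t φ))
    (hdense₁₂ : ∀ {L : CMField} {ι₁ : L →+* ℂ} (V : HermSpace3 L ι₁) (c : SeesawCtx L)
      (hW : (∀ j, 0 < (ι₁ ((dW c.D) j)).re) ∨ ∀ j, (ι₁ ((dW c.D) j)).re < 0),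
      ∀ Φ ∈ (HypCensus.Wcm hGR (@EtaChi.η @χV (@SInstance.χWR @hGR @hGR₀ @hGR₁ @μ)) (@EtaChi.hη @χV (@SInstance.χWR @hGR @hGR₀ @hGR₁ @μ)) (@EtaChi.hηc @χV (@SInstance.χWR @hGR @hGR₀ @hGR₁ @μ)) V c).SK, HypCensus.toTop (HypCensus.Wcm hGR (@EtaChi.η @χV (@SInstance.χWR @hGR @hGR₀ @hGR₁ @μ)) (@EtaChi.hη @χV (@SInstance.χWR @hGR @hGR₀ @hGR₁ @μ)) (@EtaChi.hηc @χV (@SInstance.χWR @hGR @hGR₀ @hGR₁ @μ)) V c) Φ ∈ closure (HypCensus.toTop (HypCensus.Wcm hGR (@EtaChi.η @χV (@SInstance.χWR @hGR @hGR₀ @hGR₁ @μ)) (@EtaChi.hη @χV (@SInstance.χWR @hGR @hGR₀ @hGR₁ @μ)) (@EtaChi.hηc @χV (@SInstance.χWR @hGR @hGR₀ @hGR₁ @μ)) V c) ''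
        (Submodule.span ℂ (Set.range fun q : FinSB ↥(NumberField.maximalRealSubfield L) (Fin 6) ×
          (HypCensus.printedAt V c.D hW (jD V c) (fun w => -μ c 0 w) (fun w => -μ c 1 w)).F =>
          HypCensus.ins (L : Type) (frameD V) (frameD_real V) (frameD_ne V) (dW c.D) (dW_real c.D) (dW_ne c.D) ι₁ (HypCensus.datumAt V c.D (jD V c) (HypCensus.jIOf V c.D hW))
            (fun w => -μ c 0 w) (fun w => -μ c 1 w) q.1 q.2) : Set (CMSchwartz (L : Type) 6))))
    (hdense₃₄ : ∀ {L : CMField} {ι₁ : L →+* ℂ} (V : HermSpace3 L ι₁) (c : SeesawCtx L)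
      (hW : (∀ j, 0 < (ι₁ ((dW c.D) j)).re) ∨ ∀ j, (ι₁ ((dW c.D) j)).re < 0),
      ∀ Φ ∈ (HypCensus.Wcm hGR (@EtaChi.η @χV (@SInstance.χWR @hGR @hGR₀ @hGR₁ @μ)) (@EtaChi.hη @χV (@SInstance.χWR @hGR @hGR₀ @hGR₁ @μ)) (@EtaChi.hηc @χV (@SInstance.χWR @hGR @hGR₀ @hGR₁ @μ)) V c).SK, HypCensus.toTop (HypCensus.Wcm hGR (@EtaChi.η @χV (@SInstance.χWR @hGR @hGR₀ @hGR₁ @μ)) (@EtaChi.hη @χV (@SInstance.χWR @hGR @hGR₀ @hGR₁ @μ)) (@EtaChi.hηc @χV (@SInstance.χWR @hGR @hGR₀ @hGR₁ @μ)) V c) Φ ∈ closure (HypCensus.toTop (HypCensus.Wcm hGR (@EtaChi.η @χV (@SInstance.χWR @hGR @hGR₀ @hGR₁ @μ)) (@EtaChi.hη @χV (@SInstance.χWR @hGR @hGR₀ @hGR₁ @μ)) (@EtaChi.hηc @χV (@SInstance.χWR @hGR @hGR₀ @hGR₁ @μ)) V c) ''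
        (Submodule.span ℂ (Set.range fun q : FinSB ↥(NumberField.maximalRealSubfield L) (Fin 6) ×
          (HypCensus.printedAt V c.D hW (jD V c) (fun w => -μ c 2 w) (fun w => -μ c 3 w)).F =>
          HypCensus.ins (L : Type) (frameD V) (frameD_real V) (frameD_ne V) (dW c.D) (dW_real c.D) (dW_ne c.D) ι₁ (HypCensus.datumAt V c.D (jD V c) (HypCensus.jIOf V c.D hW))
            (fun w => -μ c 2 w) (fun w => -μ c 3 w) q.1 q.2) : Set (CMSchwartz (L : Type) 6)))) :
     (picardCMUniverse hHD hI h₁ (cmAbelianVarietyRealised_of_eigenbasis hHD hI h₃)).PerL :=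
  perL_picardCM_r21AEOGISC hHD hI h₁ h₃ hA
    (HypCensus.Wcm hGR (@EtaChi.η @χV (@SInstance.χWR @hGR @hGR₀ @hGR₁ @μ)) (@EtaChi.hη @χV (@SInstance.χWR @hGR @hGR₀ @hGR₁ @μ)) (@EtaChi.hηc @χV (@SInstance.χWR @hGR @hGR₀ @hGR₁ @μ)))
    hGR χV hGR₀ hGR₁ hGR₂ hGR₃ μ hΔ₁ hΔ₂ hΔ₃ hR hΘ harch₀ hχ₀ harch₁ hχ₁
    (fun {L} {ι₁} V c hc h6 hcan =>
      Gen12PinsP.gen12_ROG_of_GOG hGR χV hGR₀ hGR₁ hGR₂ hGR₃ μ hΔ₁ hΔ₂ hΔ₃ hHD hI h₁ (cmAbelianVarietyRealised_of_eigenbasis hHD hI h₃) (orientBitι L ι₁) hA V c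
        ⟨hcan, (HodgeCM.Universe.AdelicThetaCore.thetaModel_goodCtx_iff _ (orientBitι L ι₁) (d12Of μ) (d34Of μ) ι₁ c).mp hc⟩ hc h6.1)
    real34
    (fun {L} {ι₁} V c hc h6 _ => HypCensus.hyp12_of_census hHD hI h₁ (cmAbelianVarietyRealised_of_eigenbasis hHD hI h₃) (orientBitι L ι₁) hA hGR
      (@EtaChi.η @χV (@SInstance.χWR @hGR @hGR₀ @hGR₁ @μ)) (@EtaChi.hη @χV (@SInstance.χWR @hGR @hGR₀ @hGR₁ @μ)) (@EtaChi.hηc @χV (@SInstance.χWR @hGR @hGR₀ @hGR₁ @μ))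
      (SInstance.SROG @hGR @χV @hGR₀ @hGR₁ @hGR₂ @hGR₃ @μ hΔ₁ hΔ₂ hΔ₃) μ jD hκ homg hdense₁₂ V c hc h6.1)
    (fun {L} {ι₁} V c hc h6 _ => HypCensus.hyp34_of_census hHD hI h₁ (cmAbelianVarietyRealised_of_eigenbasis hHD hI h₃) (orientBitι L ι₁) hA hGR
      (@EtaChi.η @χV (@SInstance.χWR @hGR @hGR₀ @hGR₁ @μ)) (@EtaChi.hη @χV (@SInstance.χWR @hGR @hGR₀ @hGR₁ @μ)) (@EtaChi.hηc @χV (@SInstance.χWR @hGR @hGR₀ @hGR₁ @μ))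
      (SInstance.SROG @hGR @χV @hGR₀ @hGR₁ @hGR₂ @hGR₃ @μ hΔ₁ hΔ₂ hΔ₃) μ jD hκ homg₃₄ hdense₃₄ V c hc h6.1)

end Model

end HodgeCM
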